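import Summits.QuantumFields.YangMills.Theorems.UnitScaleTiltFluctuationComparisonRegPrGlobalSlackKernelLegGeometrySum
import HarnessLib

/-!
# `UnitScaleTiltFluctuationComparisonRegPrGlobalSlackKernelLegResidual` — THE TAYLOR-SPLIT ROW IS A DEFINITION: (M1) AS A SEVENTH-ORDER RESIDUAL ROW, AND STUB 3⁗
# FROM FIVE LEG ROWS OVER `(Φ, e, B)` ONLY (crux `FluctuationComparisonRegPrIntL`, stmt-QuantumFields-20520, STUB 3⁗ `stub_globalTwoRunSlackFam`; width-lever lane A)

Seat ym-ust-19935-slack g2 (prover).  In `…KernelLegGeometrySum.K1aLegRowsG` the structure row `TaylorSplitΦ (canonPT p) Φ e B R` — «term = vacuum constant +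
Re jet₂…₆(Φ)(B) + rest» for ALL levels — is the one row that needs the undisplayed identification (M1) «the old terms of the package ARE the birth kernels paired
with the current loop variables» ([Balaban1985UV3] (43) p.266; REPORT-K1a-display-g0 §1).  But the rest `R` is a FREE object of the line: taking it to be the
RESIDUAL `canonPT − e − Re jet26(Φ)(B)` makes `TaylorSplitΦ` hold BY DEFINITION (`taylorSplitΦ_residual`), and the whole content of (M1) moves into the remainder row
`RemainderSmallΦ` FOR THE RESIDUAL: «the canonical terms differ from the order-2…6 jets of the chart family at the chosen loop variables by `O(e^{−κ𝓛}·θ(n)⁷·x⁴)`»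
— a QUANTITATIVE (seventh-order) form of (M1), which is all the two-run comparison needs (print's exact re-expansion (43) implies it with the far terms as residual;
at the birth level the residual IS `−(far + farΛ)` by the displayed `hPY`/`hPYZ`).

* §1 `residualRem p Φ e B` and `taylorSplitΦ_residual`;
* §2 **`K1aLegRowsR L 𝔠 a₀ a₁ a`** — FIVE leg rows over the objects `(Φ, e, B)` only: K1a `FlatKernelLegCauchyΦ`, (43) `KernelLegPointwiseΦ`, the RESIDUAL row
  `RemainderSmallΦ … (residualRem p Φ e B)` (= (M1) to seventh order + (57)/G3D-06), (44) `CfgDistΦ`, `CfgDistCauchyΦ`; **`k1aLegRowsG_of_R`**;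
  **`globalTwoRunSlackFam_of_k1aLegRowsR : (∀ L …, ∃ a, 0 < a ∧ a < 1 ∧ K1aLegRowsR L 𝔠 a₀ a₁ a) → ⟨THE REGISTERED TEXT OF stub_globalTwoRunSlackFam⟩`**.
Every `def … : Prop` is a hypothesis schema (never asserted); nothing of [Balaban1985UV3]/[King1986] is asserted.

References: T. Bałaban, CMP 102 (1985) 255–275 [Balaban1985UV3] ((30) p.263, (33) p.264, (43)–(44) pp.266–267, (57) p.270); C. King, CMP 102 (1986) 649–677 [King1986]
(Thm 3.4 (3.9) p.656, Prop. 3.6 (3.56) p.662).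
-/

set_option autoImplicit false

noncomputable section

open scoped BigOperators
open Literature.MathematicalPhysics.QuantumFieldTheory.Balaban1983to89
open Literature.MathematicalPhysics.QuantumFieldTheory.Balaban1983to89.T3ContinuumYM3Torus
open Literature.MathematicalPhysics.QuantumFieldTheory.Balaban1983to89.T3UnitScaleTilt
open Literature.MathematicalPhysics.QuantumFieldTheory.Balaban1983to89.T3LevelShift
open Literature.MathematicalPhysics.QuantumFieldTheory.Balaban1983to89.T3AlphaInputsAC
open Literature.MathematicalPhysics.QuantumFieldTheory.Balaban1983to89.T3AlphaPolymerSocket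
open Literature.MathematicalPhysics.QuantumFieldTheory.Balaban1983to89.T3AlphaInputsACTwoRun
open Literature.MathematicalPhysics.QuantumFieldTheory.Balaban1983to89.T3AlphaInputsACTwoRunLevel
open Summit.QuantumFields.Balaban3D.Carriers
open Summit.QuantumFields.Balaban3D.Proofs.Primitives
open Summit.QuantumFields.Balaban3D.Proofs.GroupModelLieC (lieC)
open Summit.QuantumFields.Balaban3D.Proofs.Representation33 (jet26)
open Summit.QuantumFields.YangMills.Theorems
open Summit.QuantumFields.YangMills.Theorems.GlobalSlackKernelMatching
open Summit.QuantumFields.YangMills.Theorems.GlobalSlackCanonicalPolymers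

namespace Summit.QuantumFields.YangMills.Theorems.GlobalSlackKernelLeg

variable {𝕍 : Type} [NormedAddCommGroup 𝕍] [NormedSpace ℂ 𝕍] {F : T3Family}
variable {𝔠 : AlphaConsts F.L (suGroupModel 2).N} {γ : ℝ} {hγ : 0 < γ} {hγ1 : γ ≤ (min 𝔠.gamma0 1) ^ 2}

/-! ## §1 The residual rest -/

/-- **THE RESIDUAL REST** of the canonical term function against a chart family, vacuum constants and loop variables: `R := canonPT − e − Re jet26(Φ)(B)` (at the
birth level this is `−(far + farΛ)` by `hPY`/`hPYZ`; at the old levels it is (M1)'s defect). [cite: Balaban1985UV3, (30) p.263, (43) p.266, (57) p.270] -/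
def residualRem (p : ∀ K, AlphaInputsT3AC.PkgAtV3 F 𝔠 γ hγ hγ1 K) (Φ : ChartFam 𝕍 F) (e : VacFam F) (B : CfgFam 𝕍 F) : RemFam F :=
  fun K k b Y W => canonPT p K k (1 + b) Y W - e K b Y - (jet26 (Φ K b Y) (B K k b Y W)).re

/-- **`TaylorSplitΦ` HOLDS BY DEFINITION for the residual rest.** [cite: Balaban1985UV3, (30) p.263, (43) p.266] -/
theorem taylorSplitΦ_residual (p : ∀ K, AlphaInputsT3AC.PkgAtV3 F 𝔠 γ hγ hγ1 K) (Φ : ChartFam 𝕍 F) (e : VacFam F) (B : CfgFam 𝕍 F) :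
    TaylorSplitΦ (canonPT p) Φ e B (residualRem p Φ e B) := by
  intro K k b Y W
  unfold residualRem
  ring

/-! ## §2 Five leg rows over `(Φ, e, B)`, and the registered stub -/

/-- **THE K1a LEG ROWS OVER `(Φ, e, B)` ONLY** (hypothesis schema, never asserted): `K1aLegRowsG` with the rest ELIMINATED — the remainder row is stated for the RESIDUAL
`canonPT − e − Re jet26(Φ)(B)`, i.e. «the canonical terms are the order-2…6 jets of ONE chart family at the chosen loop variables up to `C_R·e^{−𝔠.κ𝓛}·θ(n)⁷·x⁴`, in
both runs» = (M1) TO SEVENTH ORDER + the far terms (57)/G3D-06; plus K1a `FlatKernelLegCauchyΦ`, (43) `KernelLegPointwiseΦ`, (44) `CfgDistΦ`, `CfgDistCauchyΦ` at the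
canonical leg distance. [cite: Balaban1985UV3, (43)-(44) pp.266-267, (57) p.270; King1986, Prop. 3.6 (3.56) p.662, Prop. 3.9 (3.71)-(3.74) p.665] -/
def K1aLegRowsR (L : ℕ) (𝔠 : AlphaConsts L (suGroupModel 2).N) (a₀ a₁ a : ℝ) : Prop :=
  ∃ (κ' κ₁ C A C_R C_s C_B γB : ℝ), 0 < κ' ∧ κ' < κ₁ ∧ 0 ≤ C ∧ 0 ≤ A ∧ 0 ≤ C_R ∧ 0 ≤ C_s ∧ 0 ≤ C_B ∧ 0 < γB ∧
    ∀ (F : T3Family) (γ : ℝ) (hF : F.L = L) (hγ : 0 < γ), γ ≤ γB → ∀ (hγ1 : γ ≤ (min (hF ▸ 𝔠).gamma0 1) ^ 2),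
      AlphaInputsT3AC.OfV3At F (hF ▸ 𝔠) a₀ a₁ →
        ∃ (p : ∀ K, AlphaInputsT3AC.PkgAtV3 F (hF ▸ 𝔠) γ hγ hγ1 K), (∀ K, (p K).a₀ = a₀ ∧ (p K).a₁ = a₁) ∧
          ∃ (Φ : ChartFam ↥(lieC (suGroupModel 2)) F) (e : VacFam F) (B : CfgFam ↥(lieC (suGroupModel 2)) F),
            FlatKernelLegCauchyΦ (AlphaInputsT3AC.dataOfV3 p (canonPolymer p)) Φ (canonLegDist F) κ' (hF ▸ 𝔠).κ a C ∧
            KernelLegPointwiseΦ (AlphaInputsT3AC.dataOfV3 p (canonPolymer p)) Φ (canonLegDist F) κ₁ (hF ▸ 𝔠).κ A ∧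
            RemainderSmallΦ (AlphaInputsT3AC.dataOfV3 p (canonPolymer p)) (residualRem p Φ e B) (hF ▸ 𝔠).b₀ (hF ▸ 𝔠).p₀ (hF ▸ 𝔠).κ C_R ∧
            CfgDistΦ (AlphaInputsT3AC.dataOfV3 p (canonPolymer p)) B (canonLegDist F) (hF ▸ 𝔠).b₀ (hF ▸ 𝔠).p₀ C_s ∧
            CfgDistCauchyΦ (AlphaInputsT3AC.dataOfV3 p (canonPolymer p)) B (canonLegDist F) (hF ▸ 𝔠).b₀ (hF ▸ 𝔠).p₀ a C_B

/-- The five rows give the six (`R := residualRem`, `TaylorSplitΦ` by definition). [cite: Balaban1985UV3, (43) p.266] -/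
theorem k1aLegRowsG_of_R {L : ℕ} {𝔠 : AlphaConsts L (suGroupModel 2).N} {a₀ a₁ a : ℝ} (h : K1aLegRowsR L 𝔠 a₀ a₁ a) : K1aLegRowsG L 𝔠 a₀ a₁ a := by
  obtain ⟨κ', κ₁, C, A, C_R, C_s, C_B, γB, hκ', hκ1, hC, hA, hCR, hCs, hCB, hγB, hall⟩ := h
  refine ⟨κ', κ₁, C, A, C_R, C_s, C_B, γB, hκ', hκ1, hC, hA, hCR, hCs, hCB, hγB, fun F γ hF hγ hγle hγ1 hOf => ?_⟩
  obtain ⟨p, hp, Φ, e, B, hK, hP, hR, hS, hBC⟩ := hall F γ hF hγ hγle hγ1 hOf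
  exact ⟨p, hp, Φ, e, B, residualRem p Φ e B, taylorSplitΦ_residual p Φ e B, hK, hP, hR, hS, hBC⟩

/-- **THE REGISTERED STUB 3⁗ FROM FIVE LEG ROWS OVER `(Φ, e, B)`, BY NAME** (`globalTwoRunSlackFam_of_k1aLegRowsG ∘ k1aLegRowsG_of_R`): if for every odd `L ≥ 7`, every
constants record and [7]-constants there is a rate exponent `0 < a < 1` with `K1aLegRowsR L 𝔠 a₀ a₁ a`, then the text of `stub_globalTwoRunSlackFam` (skeleton v5k
`Cruxes/FluctuationComparisonRegPrIntL/Lines/birth_v5k.lean`) holds VERBATIM. [cite: King1986, Thm 3.4 (3.9) p.656, Prop. 3.6 p.662; Balaban1985UV3, (43)-(46) pp.266-267, (57) p.270] -/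
theorem globalTwoRunSlackFam_of_k1aLegRowsR
    (h : ∀ (L : ℕ), Odd L → 7 ≤ L → ∀ (𝔠 : AlphaConsts L (suGroupModel 2).N) (a₀ a₁ : ℝ), 0 < a₀ → 0 < a₁ → 𝔠.B₃ * a₁ ≤ a₀ →
      ∃ a : ℝ, 0 < a ∧ a < 1 ∧ K1aLegRowsR L 𝔠 a₀ a₁ a) :
    ∀ (L : ℕ), Odd L → 7 ≤ L → ∀ (𝔠 : Summit.QuantumFields.Balaban3D.Proofs.Primitives.AlphaConsts L (Summit.QuantumFields.Balaban3D.Carriers.suGroupModel 2).N)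
      (a₀ a₁ : ℝ), 0 < a₀ → 0 < a₁ → 𝔠.B₃ * a₁ ≤ a₀ →
      ∃ a : ℝ, 0 < a ∧ ∃ γB : ℝ, 0 < γB ∧ ∀ (F : T3Family) (γ : ℝ) (hF : F.L = L) (hγ : 0 < γ), γ ≤ γB →
        ∀ (hγ1 : γ ≤ (min (hF ▸ 𝔠).gamma0 1) ^ 2),
          Summit.QuantumFields.YangMills.Theorems.AlphaInputsT3AC.OfV3At F (hF ▸ 𝔠) a₀ a₁ →
          ∃ (p : ∀ K, Summit.QuantumFields.YangMills.Theorems.AlphaInputsT3AC.PkgAtV3 F (hF ▸ 𝔠) γ hγ hγ1 K),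
            (∀ K, (p K).a₀ = a₀ ∧ (p K).a₁ = a₁) ∧
            ∃ (π : Summit.QuantumFields.YangMills.Theorems.AlphaInputsT3AC.PolymerT3 F) (σ : ℕ) (C : ℝ), 7 ≤ σ ∧ 0 ≤ C ∧
              Summit.QuantumFields.YangMills.Theorems.GlobalSlack.GlobalSupRateTSlack (Summit.QuantumFields.YangMills.Theorems.AlphaInputsT3AC.dataOfV3 p π) (hF ▸ 𝔠).b₀ (hF ▸ 𝔠).p₀ a σ C :=
  globalTwoRunSlackFam_of_k1aLegRowsG fun L hLo h7 𝔠 a₀ a₁ ha0 ha1 hw => by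
    obtain ⟨a, ha, ha1', hc⟩ := h L hLo h7 𝔠 a₀ a₁ ha0 ha1 hw
    exact ⟨a, ha, ha1', k1aLegRowsG_of_R hc⟩

end Summit.QuantumFields.YangMills.Theorems.GlobalSlackKernelLeg

end
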